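import Literature.NumberTheory.Automorphic.WhittakerTwistedJacquet    -- ★ `Representation.charTwist`, `ker_charTwist_eq_span`
import Literature.NumberTheory.Automorphic.TwistedJacquetAdditive     -- ★ `TwistedJacquet.twistedSpan` (one-parameter currency)
import HarnessLib

/-!
# R90-TF · S4 «Ch. 13.1–2» — (ORBIT)∕(SWAP) support, part (b): TRANSPORT of the twisted spans `V(ψ_a)` —
# along homomorphisms into `G`, under rescaling of the one-parameter subgroup, along equivariant isomorphisms, and the BRIDGE to
# the `(H, θ)`-twisted coinvariants `J_{H,θ}` of ★ `Representation.charTwist`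

Cell `hodgecm-mathlib`, crux H413 (`stmt-HodgeConjecture-24833`, lane `--supports … --as helper`), route of record `HCCMUnconditional`
(no route verbs; count-neutral).  Programme R90-TF (brief `director/R90-BRIEF.v2.md` 1f40d54518340a35), section S4 = Rogawski Ch. 13.1–2
(base `R90-C131`); seat R90-C131-p01 (g0); census `R90/R90-C131-p01/g0/CENSUS-orbit.md` 62930f5ed58633f2, road (b) + bridge (br1) toward the
Whittaker-model proof of (SWAP) (= B ED. 4 `_ldsSwap`; [Rogawski1990, §11.1 p. 161]) — with ★ (c) `Theorems/R90S4TwistedCoinvariantSlot` (slot lemma,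
in the `charTwist`∕`Coinvariants` currency) and ★ (e) `Theorems/R90S4DegenerateUnipotentTrivial` (in the one-parameter `twistedSpan` currency).
THEOREMS ONLY (no `def`, no instance, no notation, no named fact, no `sorry`); ★-only imports; everything generic (`G` a group, `ρ` a complex
representation, `e : F → G`, `ψ : AddChar F Circle`).

CONTENT.
* §1 `twistedSpan_comp` — `V(ψ_a)` of `ρ ∘ f` along `e` is `V(ψ_a)` of `ρ` along `f ∘ e` (so `IrrClass.comap` of a similitude conjugation is read on the
  conjugated one-parameter subgroup); `twistedSpan_rescale` — replacing `e` by `x ↦ e(c x)` (`c ≠ 0`) replaces `ψ_{a c}` by `ψ_a`: this is how the diagonal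
  torus (`Ad(t) n(x) = n(N(α) x)`) and the outer similitude `diag(a₀, 1)` (`Ad n(x) = n(a₀ x)`) MOVE genericity between the `F^× ∕ N E^×`-orbits of
  characters; `map_twistedSpan_of_equivariant` ∕ `twistedSpan_eq_top_iff_of_equivariant` — an `e`-equivariant linear isomorphism (in particular an
  equivalence of representations, or `ρ(t)` intertwining `ρ ∘ Ad(t)` with `ρ`) carries `V(ψ_a)` onto `V′(ψ_a)`.
* §2 THE BRIDGE: if `e` maps `F` ONTO a subgroup `H ≤ G` and `θ : H →* ℂˣ` reads `θ(e x) = ψ(a x)`, then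
  `Coinvariants.ker (ρ.charTwist H θ) = twistedSpan ρ e ψ a` (`ker_charTwist_eq_twistedSpan`, from ★ `ker_charTwist_eq_span`); hence
  `J_{H,θ}(ρ) = 0 ↔ V(ψ_a) = V` (`not_nontrivial_coinvariants_iff_twistedSpan_eq_top`) — the slot lemma's conclusion feeds (e)'s hypothesis.

HONEST LABEL: HC_CM is proved only modulo the 7 printed citations (2 remaining named inputs: hLiu418 = stmt-HodgeConjecture-24832,
h413 = stmt-HodgeConjecture-24833) until rung 0 closes; this file is representation-theoretic plumbing and discharges none of them.  REL ≠ ★ ≠ BUILT.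

## References
[BernsteinZelevinskyASENS1977] I. N. Bernstein, A. V. Zelevinsky, *Induced representations of reductive p-adic groups I*, Ann. Sci. ÉNS 10 (1977), §1.8 (b) ·
[Bump1997] D. Bump, *Automorphic Forms and Representations* (1997), §4.4 p. 462 (`V_{N,ψ}`) · [Rogawski1990] J. D. Rogawski, *Automorphic Representations of
Unitary Groups in Three Variables* (1990), §11.1 p. 161 («an L-packet on `U(2)` is a `PGL₂(F)`-orbit»).
-/

set_option autoImplicit false
-- the mandated namespace (brief §3.4) repeats the single-problem summit's segment (`HodgeConjecture.HodgeConjecture`)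
set_option linter.dupNamespace false

namespace Summit.HodgeConjecture.HodgeConjecture.R90.S4

open Representation Literature.NumberTheory.Automorphic Literature.NumberTheory.Automorphic.TwistedJacquet

section Transport

variable {F : Type*} [Field F] {G G' V V' : Type*} [Group G] [Group G'] [AddCommGroup V] [Module ℂ V]
  [AddCommGroup V'] [Module ℂ V'] (ρ : Representation ℂ G V) (ψ : AddChar F Circle)

/-! ## §1 Transport along homomorphisms, rescalings and equivariant isomorphisms -/

/-- **`V(ψ_a)` of `ρ ∘ f` along `e` is `V(ψ_a)` of `ρ` along `f ∘ e`** (definitional on generators). [cite: BernsteinZelevinskyASENS1977, §1.8 (b)] -/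
theorem twistedSpan_comp (f : G' →* G) (e : F → G') (a : F) :
    twistedSpan (ρ.comp f) e ψ a = twistedSpan ρ (f ∘ e) ψ a := rfl

/-- **Rescaling the one-parameter subgroup rescales the character**: for `c ≠ 0`, `V(ψ_a)` along `x ↦ e(c x)` is `V(ψ_{a∕c})` along `e`:
`twistedSpan ρ (fun x => e (c * x)) ψ a = twistedSpan ρ e ψ (a / c)` (substitute `y = c x`).
(`Ad(t) n(x) = n(N(α) x)` for the torus, `Ad(diag(a₀,1)) n(x) = n(a₀ x)` for the outer similitude.) [cite: Rogawski1990, §11.1 p. 161] -/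
theorem twistedSpan_rescale (e : F → G) {c : F} (hc : c ≠ 0) (a : F) :
    twistedSpan ρ (fun x => e (c * x)) ψ a = twistedSpan ρ e ψ (a / c) := by
  unfold twistedSpan
  congr 1
  ext w
  constructor
  · rintro ⟨x, v, rfl⟩
    refine ⟨c * x, v, ?_⟩
    rw [← mul_assoc, div_mul_cancel₀ a hc]
  · rintro ⟨y, v, rfl⟩
    refine ⟨y / c, v, ?_⟩
    have h1 : c * (y / c) = y := by field_simp
    have h2 : a * (y / c) = a / c * y := by ring
    simp only [h1, h2]

/-- **An `e`-equivariant linear map sends `V(ψ_a)` into `V′(ψ_a)`**: for `φ : V →ₗ V′` with `φ (ρ(e x) v) = ρ′(e′ x) (φ v)`,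
`φ(V(ψ_a)) ≤ V′(ψ_a)`. [cite: BernsteinZelevinskyASENS1977, §1.8 (b)] -/
theorem map_twistedSpan_le_of_equivariant {ρ' : Representation ℂ G' V'} (e : F → G) (e' : F → G') (φ : V →ₗ[ℂ] V')
    (hφ : ∀ (x : F) (v : V), φ (ρ (e x) v) = ρ' (e' x) (φ v)) (a : F) :
    (twistedSpan ρ e ψ a).map φ ≤ twistedSpan ρ' e' ψ a := by
  rw [Submodule.map_le_iff_le_comap]
  refine Submodule.span_le.2 ?_
  rintro _ ⟨x, v, rfl⟩
  rw [SetLike.mem_coe, Submodule.mem_comap, map_sub, map_smul, hφ]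
  exact sub_smul_mem_twistedSpan ρ' e' ψ a x (φ v)

/-- **An `e`-equivariant linear ISOMORPHISM carries `V(ψ_a)` ONTO `V′(ψ_a)`** (apply the previous lemma to `φ` and `φ⁻¹`).  In particular an
equivalence of representations, or the operator `ρ(t)` intertwining `ρ ∘ Ad(t)` with `ρ`. [cite: BernsteinZelevinskyASENS1977, §1.8 (b)] -/
theorem map_twistedSpan_of_equivariant {ρ' : Representation ℂ G' V'} (e : F → G) (e' : F → G') (φ : V ≃ₗ[ℂ] V')
    (hφ : ∀ (x : F) (v : V), φ (ρ (e x) v) = ρ' (e' x) (φ v)) (a : F) :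
    (twistedSpan ρ e ψ a).map (φ : V →ₗ[ℂ] V') = twistedSpan ρ' e' ψ a := by
  refine le_antisymm (map_twistedSpan_le_of_equivariant ρ ψ e e' (φ : V →ₗ[ℂ] V') hφ a) ?_
  have hφ' : ∀ (x : F) (v' : V'), φ.symm (ρ' (e' x) v') = ρ (e x) (φ.symm v') := by
    intro x v'
    apply φ.injective
    rw [LinearEquiv.apply_symm_apply, hφ, LinearEquiv.apply_symm_apply]
  have h := map_twistedSpan_le_of_equivariant ρ' ψ e' e (φ.symm : V' →ₗ[ℂ] V) hφ' a
  intro w hw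
  refine ⟨φ.symm w, h ⟨w, hw, rfl⟩, φ.apply_symm_apply w⟩

/-- **`V(ψ_a) = V ↔ V′(ψ_a) = V′`** across an `e`-equivariant linear isomorphism. [cite: BernsteinZelevinskyASENS1977, §1.8 (b)] -/
theorem twistedSpan_eq_top_iff_of_equivariant {ρ' : Representation ℂ G' V'} (e : F → G) (e' : F → G') (φ : V ≃ₗ[ℂ] V')
    (hφ : ∀ (x : F) (v : V), φ (ρ (e x) v) = ρ' (e' x) (φ v)) (a : F) :
    twistedSpan ρ e ψ a = ⊤ ↔ twistedSpan ρ' e' ψ a = ⊤ := by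
  rw [← map_twistedSpan_of_equivariant ρ ψ e e' φ hφ a]
  constructor
  · intro h
    rw [h, Submodule.map_top, LinearMap.range_eq_top]
    exact φ.surjective
  · intro h
    apply Submodule.map_injective_of_injective (f := (φ : V →ₗ[ℂ] V')) φ.injective
    rw [h, Submodule.map_top]
    exact (LinearMap.range_eq_top.2 φ.surjective).symm

/-! ## §2 The bridge: `Coinvariants.ker (ρ|_H ⊗ θ⁻¹) = V(ψ_a)` when `e : F ↠ H` and `θ ∘ e = ψ_a` -/

/-- **`Coinvariants.ker (ρ.charTwist H θ) = twistedSpan ρ e ψ a`** when the one-parameter subgroup `e` maps `F` onto `H` and `θ(e x) = ψ(a x)`: the two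
kernels have the same generators `ρ(h) v - θ(h) v = ρ(e x) v - ψ(a x) v` (★ `ker_charTwist_eq_span`). [cite: BernsteinZelevinskyASENS1977, §1.8 (b)] [cite: Bump1997, §4.4 p. 462] -/
theorem ker_charTwist_eq_twistedSpan (H : Subgroup G) (θ : ↥H →* ℂˣ) (e : F → G) (he : ∀ x, e x ∈ H)
    (hsurj : ∀ h : ↥H, ∃ x, e x = h) (a : F) (hθ : ∀ x, ((θ ⟨e x, he x⟩ : ℂˣ) : ℂ) = (ψ (a * x) : ℂ)) :
    Coinvariants.ker (ρ.charTwist H θ) = twistedSpan ρ e ψ a := by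
  rw [ker_charTwist_eq_span]
  unfold twistedSpan
  congr 1
  ext w
  constructor
  · rintro ⟨⟨h, v⟩, rfl⟩
    obtain ⟨x, hx⟩ := hsurj h
    refine ⟨x, v, ?_⟩
    have hh : h = ⟨e x, he x⟩ := Subtype.ext hx.symm
    subst hh
    change ρ (e x) v - (θ ⟨e x, he x⟩ : ℂˣ) • v = ρ (e x) v - (ψ (a * x) : ℂ) • v
    rw [Units.smul_def, hθ]
  · rintro ⟨x, v, rfl⟩
    refine ⟨⟨⟨e x, he x⟩, v⟩, ?_⟩
    change ρ (e x) v - (θ ⟨e x, he x⟩ : ℂˣ) • v = ρ (e x) v - (ψ (a * x) : ℂ) • v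
    rw [Units.smul_def, hθ]

/-- **`J_{H,θ}(ρ) = 0 ↔ V(ψ_a) = V`** under the same hypotheses: the slot lemma's conclusion «not `(H, θ)`-generic» (★
`Theorems/R90S4TwistedCoinvariantSlot`) is the hypothesis «`V(ψ_a) = V`» of DEGENERATE ⇒ TRIVIAL (★ `Theorems/R90S4DegenerateUnipotentTrivial`).
[cite: BernsteinZelevinskyASENS1977, §1.8 (b)] -/
theorem not_nontrivial_coinvariants_iff_twistedSpan_eq_top (H : Subgroup G) (θ : ↥H →* ℂˣ) (e : F → G) (he : ∀ x, e x ∈ H)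
    (hsurj : ∀ h : ↥H, ∃ x, e x = h) (a : F) (hθ : ∀ x, ((θ ⟨e x, he x⟩ : ℂˣ) : ℂ) = (ψ (a * x) : ℂ)) :
    ¬ Nontrivial (ρ.charTwist H θ).Coinvariants ↔ twistedSpan ρ e ψ a = ⊤ := by
  rw [← ker_charTwist_eq_twistedSpan ρ ψ H θ e he hsurj a hθ, not_nontrivial_iff_subsingleton]
  exact Submodule.Quotient.subsingleton_iff

end Transport

end Summit.HodgeConjecture.HodgeConjecture.R90.S4
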